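import Mathlib
import Summits.CriticalPhenomena.PercolationContinuityZ3.Theorems.PercNearOneGluingNoHeavyLowerTailOrderedDifferencesTwoChain

/-!
# 2-chain periodicity from reciprocal certificates; the almost-disjoint class

Helper file for crux `stmt-CriticalPhenomena-4575` (`NoHeavyLowerTail`, route `PercNearOneGluingNoHeavy`),
new-inequality factory seat `prim-ineq-gen-3` (gen 22).  Everything here is PROVED; no definitions.

Notation (memo `run/shared/lean/prim/prim-ineq-gen-3/CONJECTURE-P2.md`): `D = 𝒜 \\ 𝒜`, `Z C E = [E ⊆ C]`,
`Y C E = [E ∩ C = ∅]`.  A relation is a pair `(λ, μ)` with `∑_C λ_C [E ⊆ C] = ∑_C μ_C [E ∩ C = ∅]` for all `E ∈ D`;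
P2 ("2-chain periodicity") says that `λ → μ → ν` forces `λ = ν`.  A RECIPROCAL CERTIFICATE for `A ∈ 𝒜` is a pair
`p q : D → K` with `Z p = δ_A = Y q` and `Y p = Z q` (as functions of the member).

* `twoChain_of_certificates` — if EVERY member of `𝒜` has a reciprocal certificate then P2 holds for `𝒜`
  (over any field): pairing the two relations with `p` and `q` gives `λ_A = ν_A`.  (CONJECTURE-P2 §1 form (c);
  conjecturally the hypothesis always holds.)
* `twoChain_of_almostDisjoint` — ★ a NEW class where P2 is a theorem: families whose members have at least three
  elements, pairwise meet in at most one element ("almost disjoint", e.g. the lines of a partial linear space) and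
  each have a disjoint partner in the family (e.g. the lines of an affine plane, the edges of a graph in which every
  edge misses some other edge, laminar-free configurations).  The certificate of a member `A` with touched points
  `P_A = {x ∈ A : x ∈ C for some C ≠ A}` is `p = ∑_{x ∈ P_A} e_{A \ {x}} - (#P_A - 1) e_A`, `q = e_∅ - p`
  (the case `|A ∩ C| ≤ 1` of the trace-Möbius certificate of memo §15, THEOREM K).
* `linearIndependent_pencil_of_almostDisjoint` — hence the pencil rows `[E ⊆ C] + t [E ∩ C = ∅]` of such a
  family are independent over every field for `t * t ≠ 1`.
(prim-ineq-gen-3 gen 22, 2026-08-24.)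
-/

namespace Summit.CriticalPhenomena.PercolationContinuityZ3.Theorems

namespace OrderedDifferences

open Finset
open scoped FinsetFamily

variable {α : Type*} [DecidableEq α] {K : Type*} [Field K]

/-- Fubini step: pairing a row identity `∑_C a_C g(E,C)` with a coefficient vector `r` on the columns. -/
private theorem pair_rows_aux (𝒜 : Finset (Finset α)) (a r : Finset α → K) (g : Finset α → Finset α → K) :
    ∑ E ∈ 𝒜 \\ 𝒜, r E * ∑ C ∈ 𝒜, a C * g E C = ∑ C ∈ 𝒜, a C * ∑ E ∈ 𝒜 \\ 𝒜, r E * g E C := by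
  calc ∑ E ∈ 𝒜 \\ 𝒜, r E * ∑ C ∈ 𝒜, a C * g E C
      = ∑ E ∈ 𝒜 \\ 𝒜, ∑ C ∈ 𝒜, r E * (a C * g E C) := by
        refine sum_congr rfl fun E _ => ?_
        rw [mul_sum]
    _ = ∑ C ∈ 𝒜, ∑ E ∈ 𝒜 \\ 𝒜, r E * (a C * g E C) := sum_comm
    _ = ∑ C ∈ 𝒜, a C * ∑ E ∈ 𝒜 \\ 𝒜, r E * g E C := by
        refine sum_congr rfl fun C _ => ?_
        rw [mul_sum]
        exact sum_congr rfl fun E _ => by ring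

/-- **Certificates for all members give 2-chain periodicity.**  If every `A ∈ 𝒜` has coefficient vectors `p q` on
`𝒜 \\ 𝒜` with `∑_E p_E [E ⊆ C] = [C = A] = ∑_E q_E [E ∩ C = ∅]` and `∑_E p_E [E ∩ C = ∅] = ∑_E q_E [E ⊆ C]` for all
`C ∈ 𝒜`, then `λ Z = μ Y` and `μ Z = ν Y` on `𝒜 \\ 𝒜` imply `λ = ν` (P2, over any field; in the form consumed by
`linearIndependent_pencil_of_twoChain`). -/
theorem twoChain_of_certificates (𝒜 : Finset (Finset α))
    (hcert : ∀ A ∈ 𝒜, ∃ p q : Finset α → K,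
        (∀ C ∈ 𝒜, ∑ E ∈ 𝒜 \\ 𝒜, p E * (if E ⊆ C then (1 : K) else 0) = if C = A then 1 else 0) ∧
        (∀ C ∈ 𝒜, ∑ E ∈ 𝒜 \\ 𝒜, q E * (if Disjoint E C then (1 : K) else 0) = if C = A then 1 else 0) ∧
        (∀ C ∈ 𝒜, ∑ E ∈ 𝒜 \\ 𝒜, p E * (if Disjoint E C then (1 : K) else 0) =
          ∑ E ∈ 𝒜 \\ 𝒜, q E * (if E ⊆ C then (1 : K) else 0)))
    (l m n : ↥𝒜 → K)
    (h1 : ∀ E ∈ 𝒜 \\ 𝒜, ∑ A : 𝒜, l A * (if E ⊆ (A : Finset α) then (1 : K) else 0) =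
        ∑ A : 𝒜, m A * (if Disjoint E (A : Finset α) then (1 : K) else 0))
    (h2 : ∀ E ∈ 𝒜 \\ 𝒜, ∑ A : 𝒜, m A * (if E ⊆ (A : Finset α) then (1 : K) else 0) =
        ∑ A : 𝒜, n A * (if Disjoint E (A : Finset α) then (1 : K) else 0)) :
    l = n := by
  classical
  -- pass to functions on `Finset α`
  let l' : Finset α → K := fun C => if h : C ∈ 𝒜 then l ⟨C, h⟩ else 0
  let m' : Finset α → K := fun C => if h : C ∈ 𝒜 then m ⟨C, h⟩ else 0
  let n' : Finset α → K := fun C => if h : C ∈ 𝒜 then n ⟨C, h⟩ else 0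
  have hl' : ∀ A : 𝒜, l' A = l A := fun A => by simp only [l', dif_pos A.2]
  have hm' : ∀ A : 𝒜, m' A = m A := fun A => by simp only [m', dif_pos A.2]
  have hn' : ∀ A : 𝒜, n' A = n A := fun A => by simp only [n', dif_pos A.2]
  have conv : ∀ (f : ↥𝒜 → K) (f' : Finset α → K), (∀ A : 𝒜, f' A = f A) → ∀ g : Finset α → K,
      ∑ C ∈ 𝒜, f' C * g C = ∑ A : 𝒜, f A * g A := by
    intro f f' hf g
    rw [← sum_attach 𝒜, univ_eq_attach]
    exact sum_congr rfl fun A _ => by rw [hf A]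
  have h1' : ∀ E ∈ 𝒜 \\ 𝒜, ∑ C ∈ 𝒜, l' C * (if E ⊆ C then (1 : K) else 0) =
      ∑ C ∈ 𝒜, m' C * (if Disjoint E C then (1 : K) else 0) := by
    intro E hE
    rw [conv l l' hl', conv m m' hm']
    exact h1 E hE
  have h2' : ∀ E ∈ 𝒜 \\ 𝒜, ∑ C ∈ 𝒜, m' C * (if E ⊆ C then (1 : K) else 0) =
      ∑ C ∈ 𝒜, n' C * (if Disjoint E C then (1 : K) else 0) := by
    intro E hE
    rw [conv m m' hm', conv n n' hn']
    exact h2 E hE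
  funext A
  obtain ⟨p, q, hp, hq, hpq⟩ := hcert A A.2
  have hδ : ∀ f' : Finset α → K, ∑ C ∈ 𝒜, f' C * (if C = (A : Finset α) then (1 : K) else 0) = f' A := by
    intro f'
    simp_rw [mul_boole]
    rw [sum_ite_eq', if_pos A.2]
  -- λ_A = ∑_C μ_C (Y p)_C
  have e1 : l' A = ∑ C ∈ 𝒜, m' C * ∑ E ∈ 𝒜 \\ 𝒜, p E * (if Disjoint E C then (1 : K) else 0) := by
    have e : ∑ E ∈ 𝒜 \\ 𝒜, p E * ∑ C ∈ 𝒜, l' C * (if E ⊆ C then (1 : K) else 0) =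
        ∑ E ∈ 𝒜 \\ 𝒜, p E * ∑ C ∈ 𝒜, m' C * (if Disjoint E C then (1 : K) else 0) :=
      sum_congr rfl fun E hE => by rw [h1' E hE]
    rw [pair_rows_aux 𝒜 l' p (fun E C => if E ⊆ C then (1 : K) else 0),
      pair_rows_aux 𝒜 m' p (fun E C => if Disjoint E C then (1 : K) else 0)] at e
    rw [← e, ← hδ l']
    exact (sum_congr rfl fun C hC => by rw [hp C hC]).symm
  -- ν_A = ∑_C μ_C (Z q)_C
  have e2 : n' A = ∑ C ∈ 𝒜, m' C * ∑ E ∈ 𝒜 \\ 𝒜, q E * (if E ⊆ C then (1 : K) else 0) := by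
    have e : ∑ E ∈ 𝒜 \\ 𝒜, q E * ∑ C ∈ 𝒜, m' C * (if E ⊆ C then (1 : K) else 0) =
        ∑ E ∈ 𝒜 \\ 𝒜, q E * ∑ C ∈ 𝒜, n' C * (if Disjoint E C then (1 : K) else 0) :=
      sum_congr rfl fun E hE => by rw [h2' E hE]
    rw [pair_rows_aux 𝒜 m' q (fun E C => if E ⊆ C then (1 : K) else 0),
      pair_rows_aux 𝒜 n' q (fun E C => if Disjoint E C then (1 : K) else 0)] at e
    rw [e, ← hδ n']
    exact (sum_congr rfl fun C hC => by rw [hq C hC]).symm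
  rw [← hl' A, ← hn' A, e1, e2]
  exact sum_congr rfl fun C hC => by rw [hpq C hC]

/-- **P2 for almost-disjoint families with disjoint partners.**  If every member of `𝒜` has at least three elements,
two distinct members share at most one element, and every member is disjoint from some other member, then 2-chain
periodicity holds: `λ Z = μ Y` and `μ Z = ν Y` on `𝒜 \\ 𝒜` force `λ = ν` (over any field).  The certificate of `A` is
`p = ∑_{x ∈ P_A} e_{A \ {x}} - (#P_A - 1) e_A`, `q = e_∅ - p`, where `P_A` is the set of points of `A` met by other members. -/
theorem twoChain_of_almostDisjoint (𝒜 : Finset (Finset α))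
    (h3 : ∀ A ∈ 𝒜, 3 ≤ #A) (h1 : ∀ A ∈ 𝒜, ∀ B ∈ 𝒜, A ≠ B → #(A ∩ B) ≤ 1)
    (hd : ∀ A ∈ 𝒜, ∃ B ∈ 𝒜, Disjoint A B)
    (l m n : ↥𝒜 → K)
    (hr1 : ∀ E ∈ 𝒜 \\ 𝒜, ∑ A : 𝒜, l A * (if E ⊆ (A : Finset α) then (1 : K) else 0) =
        ∑ A : 𝒜, m A * (if Disjoint E (A : Finset α) then (1 : K) else 0))
    (hr2 : ∀ E ∈ 𝒜 \\ 𝒜, ∑ A : 𝒜, m A * (if E ⊆ (A : Finset α) then (1 : K) else 0) =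
        ∑ A : 𝒜, n A * (if Disjoint E (A : Finset α) then (1 : K) else 0)) :
    l = n := by
  classical
  refine twoChain_of_certificates 𝒜 (fun A hA => ?_) l m n hr1 hr2
  -- the touched points of `A` and the certificate
  set P : Finset α := A.filter (fun x => ∃ C ∈ 𝒜, C ≠ A ∧ x ∈ C) with hPdef
  let p : Finset α → K := fun E =>
    (∑ x ∈ P, if E = A \ {x} then (1 : K) else 0) - (if E = A then ((#P : K) - 1) else 0)
  -- membership of the columns used
  obtain ⟨B₀, hB₀, hAB₀⟩ := hd A hA
  have hAmem : A ∈ 𝒜 \\ 𝒜 := by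
    rw [mem_diffs]; exact ⟨A, hA, B₀, hB₀, sdiff_eq_self_of_disjoint hAB₀⟩
  have h0mem : (∅ : Finset α) ∈ 𝒜 \\ 𝒜 := by
    rw [mem_diffs]; exact ⟨A, hA, A, hA, by simp⟩
  -- a member `C ≠ A` meeting `A` meets it in exactly one point
  have hmeet : ∀ C ∈ 𝒜, C ≠ A → ∀ x ∈ A, x ∈ C → A ∩ C = {x} := by
    intro C hC hCA x hxA hxC
    have hx : x ∈ A ∩ C := mem_inter.mpr ⟨hxA, hxC⟩
    have hcard : #(A ∩ C) ≤ 1 := h1 A hA C hC (Ne.symm hCA)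
    exact (eq_singleton_iff_unique_mem.mpr ⟨hx, fun y hy =>
      card_le_one.mp hcard y hy x hx⟩)
  have hPx : ∀ x ∈ P, A \ {x} ∈ 𝒜 \\ 𝒜 := by
    intro x hx
    obtain ⟨hxA, C, hC, hCA, hxC⟩ := mem_filter.mp hx
    rw [mem_diffs]
    refine ⟨A, hA, C, hC, ?_⟩
    rw [← sdiff_inter_self_left, hmeet C hC hCA x hxA hxC]
  -- evaluation of the certificate sums
  have hsum : ∀ g : Finset α → K, ∑ E ∈ 𝒜 \\ 𝒜, p E * g E =
      (∑ x ∈ P, g (A \ {x})) - ((#P : K) - 1) * g A := by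
    intro g
    have e1 : ∑ E ∈ 𝒜 \\ 𝒜, p E * g E =
        ∑ E ∈ 𝒜 \\ 𝒜, (∑ x ∈ P, (if E = A \ {x} then (1 : K) else 0) * g E) -
          ∑ E ∈ 𝒜 \\ 𝒜, (if E = A then ((#P : K) - 1) else 0) * g E := by
      rw [← sum_sub_distrib]
      refine sum_congr rfl fun E _ => ?_
      simp only [p]
      rw [sub_mul, sum_mul]
    rw [e1]
    congr 1
    · rw [sum_comm]
      refine sum_congr rfl fun x hx => ?_
      simp_rw [ite_mul, one_mul, zero_mul]
      rw [sum_ite_eq' (𝒜 \\ 𝒜) (A \ {x}), if_pos (hPx x hx)]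
    · simp_rw [ite_mul, zero_mul]
      rw [sum_ite_eq' (𝒜 \\ 𝒜) A, if_pos hAmem]
  -- cardinality helper: removing one point from a member leaves at least two points
  have hbig : ∀ C ∈ 𝒜, ∀ x : α, 2 ≤ #(C \ {x}) := by
    intro C hC x
    have h := h3 C hC
    rw [sdiff_singleton_eq_erase]
    have := pred_card_le_card_erase (s := C) (a := x)
    omega
  -- the key evaluations of `Z p` and `Y p` at a member `C`
  have hZp : ∀ C ∈ 𝒜, (∑ x ∈ P, (if A \ {x} ⊆ C then (1 : K) else 0)) -
      ((#P : K) - 1) * (if A ⊆ C then (1 : K) else 0) = if C = A then 1 else 0 := by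
    intro C hC
    by_cases hCA : C = A
    · subst hCA
      rw [if_pos rfl, if_pos subset_rfl]
      have e : ∑ x ∈ P, (if C \ {x} ⊆ C then (1 : K) else 0) = ∑ x ∈ P, (1 : K) :=
        sum_congr rfl fun x _ => if_pos sdiff_subset
      rw [e, sum_const, nsmul_eq_mul, mul_one]; ring
    · rw [if_neg hCA]
      have hnot : ∀ x ∈ P, ¬ A \ {x} ⊆ C := by
        intro x _ hsub
        have hle : #(A \ {x}) ≤ #(A ∩ C) := card_le_card (subset_inter sdiff_subset hsub)
        have h2 := hbig A hA x
        have := h1 A hA C hC (Ne.symm hCA)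
        omega
      have hnotA : ¬ A ⊆ C := by
        intro hsub
        have hle : #A ≤ #(A ∩ C) := card_le_card (subset_inter subset_rfl hsub)
        have := h1 A hA C hC (Ne.symm hCA)
        have := h3 A hA
        omega
      rw [if_neg hnotA, sum_congr rfl fun x hx => if_neg (hnot x hx), sum_const_zero]
      ring
  have hYp : ∀ C ∈ 𝒜, (∑ x ∈ P, (if Disjoint (A \ {x}) C then (1 : K) else 0)) -
      ((#P : K) - 1) * (if Disjoint A C then (1 : K) else 0) = if C = A then 0 else 1 := by
    intro C hC
    by_cases hCA : C = A
    · subst hCA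
      rw [if_pos rfl]
      have hne : C.Nonempty := card_pos.mp (by have := h3 C hC; omega)
      have hnd : ¬ Disjoint C C := fun h => hne.ne_empty ((disjoint_self_iff_empty C).mp h)
      have hnot : ∀ x ∈ P, ¬ Disjoint (C \ {x}) C := by
        intro x _ h
        have hempty : C \ {x} = ∅ := (disjoint_self_iff_empty _).mp (h.mono_right sdiff_subset)
        have h2 := hbig C hC x
        rw [hempty, card_empty] at h2
        omega
      rw [if_neg hnd, sum_congr rfl fun x hx => if_neg (hnot x hx), sum_const_zero]
      ring
    · rw [if_neg hCA]
      by_cases hdis : Disjoint A C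
      · rw [if_pos hdis]
        have e : ∑ x ∈ P, (if Disjoint (A \ {x}) C then (1 : K) else 0) = ∑ x ∈ P, (1 : K) :=
          sum_congr rfl fun x _ => if_pos (hdis.mono_left sdiff_subset)
        rw [e, sum_const, nsmul_eq_mul, mul_one]; ring
      · rw [if_neg hdis]
        -- `A ∩ C = {y}` for a unique touched point `y`
        obtain ⟨y, hy⟩ := not_disjoint_iff.mp hdis
        have hAC : A ∩ C = {y} := hmeet C hC hCA y hy.1 hy.2
        have hyP : y ∈ P := mem_filter.mpr ⟨hy.1, C, hC, hCA, hy.2⟩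
        have hiff : ∀ x ∈ P, Disjoint (A \ {x}) C ↔ x = y := by
          intro x _
          constructor
          · intro h
            by_contra hxy
            have hyin : y ∈ A \ {x} := mem_sdiff.mpr ⟨hy.1, by rwa [mem_singleton, eq_comm] ⟩
            exact disjoint_left.mp h hyin hy.2
          · rintro rfl
            rw [disjoint_left]
            intro z hz hzC
            have hz' : z ∈ A ∩ C := mem_inter.mpr ⟨(mem_sdiff.mp hz).1, hzC⟩
            rw [hAC, mem_singleton] at hz'
            exact (mem_sdiff.mp hz).2 (mem_singleton.mpr hz')
        rw [sum_congr rfl fun x hx => show (if Disjoint (A \ {x}) C then (1 : K) else 0) =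
            (if x = y then (1 : K) else 0) by rw [if_congr (hiff x hx) rfl rfl]]
        rw [sum_ite_eq' P y, if_pos hyP]; ring
  refine ⟨p, fun E => (if E = ∅ then (1 : K) else 0) - p E, ?_, ?_, ?_⟩
  · intro C hC
    rw [hsum]; exact hZp C hC
  · intro C hC
    simp only [sub_mul, sum_sub_distrib]
    rw [hsum]
    simp_rw [ite_mul, one_mul, zero_mul]
    rw [sum_ite_eq' (𝒜 \\ 𝒜) ∅, if_pos h0mem, if_pos (disjoint_empty_left C), hYp C hC]
    by_cases hCA : C = A
    · rw [if_pos hCA, if_pos hCA]; ring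
    · rw [if_neg hCA, if_neg hCA]; ring
  · intro C hC
    simp only [sub_mul, sum_sub_distrib]
    rw [hsum, hsum]
    simp_rw [ite_mul, one_mul, zero_mul]
    rw [sum_ite_eq' (𝒜 \\ 𝒜) ∅, if_pos h0mem, if_pos (empty_subset C), hYp C hC, hZp C hC]
    by_cases hCA : C = A
    · rw [if_pos hCA, if_pos hCA]; ring
    · rw [if_neg hCA, if_neg hCA]; ring

/-- **The pencil theorem over every field for almost-disjoint families with disjoint partners.**  Under the
hypotheses of `twoChain_of_almostDisjoint`, the pencil rows `C ↦ (E ↦ [E ⊆ C] + t [E ∩ C = ∅])` over `𝒜 \\ 𝒜` are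
linearly independent for every `t` with `t * t ≠ 1`. -/
theorem linearIndependent_pencil_of_almostDisjoint (𝒜 : Finset (Finset α))
    (h3 : ∀ A ∈ 𝒜, 3 ≤ #A) (h1 : ∀ A ∈ 𝒜, ∀ B ∈ 𝒜, A ≠ B → #(A ∩ B) ≤ 1)
    (hd : ∀ A ∈ 𝒜, ∃ B ∈ 𝒜, Disjoint A B) {t : K} (ht : t * t ≠ 1) :
    LinearIndependent K (fun A : 𝒜 => fun E : (𝒜 \\ 𝒜 : Finset (Finset α)) =>
      (if (E : Finset α) ⊆ (A : Finset α) then (1 : K) else 0) +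
        t * (if Disjoint (E : Finset α) (A : Finset α) then (1 : K) else 0)) :=
  linearIndependent_pencil_of_twoChain 𝒜 (fun l m n h1' h2' => twoChain_of_almostDisjoint 𝒜 h3 h1 hd l m n h1' h2') ht

end OrderedDifferences

end Summit.CriticalPhenomena.PercolationContinuityZ3.Theorems
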